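import Mathlib
import Summits.Ventures.PercRepro2.CoinContract
import Summits.Ventures.PercRepro2.CoinContractDarc
import Summits.Ventures.PercRepro2.CoinLsmHead
import Summits.Ventures.PercRepro2.CoinForestLaw
import Summits.Ventures.PercRepro2.CoinForestHead

/-!
# The forest head with a TARGET SET (blind cell PercRepro2, night-2 g5; NIGHT2-DARC.md §27, §18)

`darc_of_forestHead_mixed_set`: `darc_of_forestHead_mixed` for a target set `T` (forest arcs may
end anywhere in `T`), by the §18 contraction of `T` to `t₀ ∈ T` (`darc_contract_iff`): the
contracted system has the same arm coins `{w → v}`, forest coins `{v → rename (par v)}` with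
`rename (par v) ∈ Vs ∪ {t₀}`, the same rank, and the same «only coins with tails in `P`».
-/

namespace Summit.Ventures.PercRepro2.Coin

section ForestHeadSet

open Classical

variable {V : Type*} {E : Type*} [Fintype V] [DecidableEq V] [Fintype E] [DecidableEq E]
  {R : Type*} [Field R] [LinearOrder R] [IsStrictOrderedRing R]

omit [Fintype V] [Fintype E] [DecidableEq E] in
/-- A single-arc coin with both ends outside `T` is unchanged by the contraction. -/
lemma contract_singleton_of_notMem {T : Finset V} {t₀ : V} {arcs : E → Finset (V × V)} {e : E}
    {x y : V} (h : arcs e = {(x, y)}) (hx : x ∉ T) :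
    contract arcs T t₀ e = {(x, rename T t₀ y)} := by
  simp [contract, h, rename_of_notMem hx]

omit [Fintype V] [Fintype E] [DecidableEq E] in
/-- An arc of the contracted system with tail outside `T` comes from an arc with the same tail. -/
lemma contract_arc_tail {T : Finset V} {t₀ : V} (ht₀ : t₀ ∈ T) {arcs : E → Finset (V × V)}
    {e : E} {x' y' : V} (h : (x', y') ∈ contract arcs T t₀ e) (hx' : x' ∉ T) :
    ∃ y, (x', y) ∈ arcs e := by
  simp only [contract, Finset.mem_image, Prod.mk.injEq, Prod.exists] at h
  obtain ⟨x, y, hxy, hx, _⟩ := h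
  have : x ∉ T := fun hxT => hx' (hx ▸ (rename_mem_iff ht₀ x).mpr hxT)
  rw [rename_of_notMem this] at hx
  exact ⟨y, hx ▸ hxy⟩

/-- **THEOREM (row 2′DARC at every forest head, target SET).** -/
theorem darc_of_forestHead_mixed_set (p : E → R) (hp : IsProbVec p) {arcs : E → Finset (V × V)}
    (hS : SameEnds arcs) (s a b u w : V) {T : Finset V} {t₀ : V} (ht₀ : t₀ ∈ T) (Vs : Finset V)
    (hwV : w ∉ Vs) (hPT : Disjoint (insert w Vs) T) (hs : s ∉ T) (A : Finset V) (hAV : A ⊆ Vs)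
    {c d : V → E} {par : V → V} (hc : ∀ v ∈ A, arcs (c v) = {(w, v)})
    (hd : ∀ v ∈ Vs, arcs (d v) = {(v, par v)}) (hpar : ∀ v ∈ Vs, par v ∈ Vs ∨ par v ∈ T)
    (honly : OnlyForestCoins arcs w A Vs c d) {rk : V → ℕ}
    (hrk : ∀ v ∈ Vs, par v ∈ Vs → rk (par v) < rk v)
    (ha : a ∉ insert w Vs ∪ T) (hb : b ∉ insert w Vs ∪ T) (hu : u ∉ insert w Vs ∪ T)
    (hP : ∀ Z ∈ (insert w Vs).powerset,
      0 < prob p (avoidEvent (arcsOff arcs (insert w Vs ∪ T)) s (Z ∪ T)))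
    (hQ : ∀ Z ∈ (insert w Vs).powerset,
      0 < prob p (avoidEvent (arcsOff arcs (insert w Vs ∪ T)) s (gateTarget u w Z T))) :
    DARC p arcs s T a b u w := by
  have hwT : w ∉ T := Finset.disjoint_left.mp hPT (Finset.mem_insert_self w Vs)
  have hvT : ∀ v ∈ Vs, v ∉ T := fun v hv =>
    Finset.disjoint_left.mp hPT (Finset.mem_insert_of_mem hv)
  have haT : a ∉ T := fun h => ha (Finset.mem_union_right _ h)
  have hbT : b ∉ T := fun h => hb (Finset.mem_union_right _ h)
  have huT : u ∉ T := fun h => hu (Finset.mem_union_right _ h)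
  have ht₀V : t₀ ∉ Vs := fun h => hvT t₀ h ht₀
  have hwt₀ : w ≠ t₀ := fun h => hwT (h ▸ ht₀)
  rw [darc_contract_iff p ht₀ hs haT hbT huT hwT]
  refine darc_of_forestHead_mixed p hp (sameEnds_contract hS) s a b u w t₀ Vs hwV ht₀V hwt₀ A hAV
    (c := c) (d := d) (par := fun v => rename T t₀ (par v)) ?_ ?_ ?_ ?_ (rk := rk) ?_ ?_ ?_ ?_
    ?_ ?_
  · intro v hv
    rw [contract_singleton_of_notMem (hc v hv) hwT, rename_of_notMem (hvT v (hAV hv))]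
  · intro v hv
    exact contract_singleton_of_notMem (hd v hv) (hvT v hv)
  · intro v hv
    rcases hpar v hv with h | h
    · exact Or.inl (by rw [rename_of_notMem (hvT _ h)]; exact h)
    · exact Or.inr (rename_of_mem h)
  · rintro e ⟨⟨x', y'⟩, hxy, hx'⟩
    have hx'T : x' ∉ T := by
      rcases hx' with rfl | h
      · exact hwT
      · exact hvT _ h
    obtain ⟨y, hxy'⟩ := contract_arc_tail ht₀ hxy hx'T
    exact honly e ⟨(x', y), hxy', hx'⟩
  · intro v hv h
    rcases hpar v hv with h' | h'
    · rw [rename_of_notMem (hvT _ h')] at h ⊢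
      exact hrk v hv h'
    · rw [rename_of_mem h'] at h
      exact absurd h ht₀V
  · intro h
    rcases Finset.mem_union.mp h with h | h
    · exact ha (Finset.mem_union_left _ h)
    · exact haT (Finset.mem_singleton.mp h ▸ ht₀)
  · intro h
    rcases Finset.mem_union.mp h with h | h
    · exact hb (Finset.mem_union_left _ h)
    · exact hbT (Finset.mem_singleton.mp h ▸ ht₀)
  · intro h
    rcases Finset.mem_union.mp h with h | h
    · exact hu (Finset.mem_union_left _ h)
    · exact huT (Finset.mem_singleton.mp h ▸ ht₀)
  · intro Z hZ
    rw [avoid_reduced_contract ht₀ hPT hs (Finset.mem_powerset.mp hZ)]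
    exact hP Z hZ
  · intro Z hZ
    rw [avoid_reduced_gate_contract ht₀ hPT hs huT (Finset.mem_powerset.mp hZ)]
    exact hQ Z hZ

end ForestHeadSet

end Summit.Ventures.PercRepro2.Coin
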